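import Mathlib
import HarnessLib
import Literature.MathematicalPhysics.QuantumLattice.XYOrder
import Literature.MathematicalPhysics.QuantumLattice.XYOrderInfrared

/-!
# Sketch — crux-ideate stmt-AtomisticToContinuum-9671 (KineticLatticeBEC), ideator 3, round 1

First-lemma signatures for the two crux idea cards of this seat (Props only, no proofs):

* card `odd-checkerboard-reflection-positivity`: `blockSign`, `IsCubeConstant`,
  `CheckerboardGaussianDomination` (first lemma), `CheckerboardFaceOrder` (the line's free output),
  `UniformFaceOrderTransfer` (the transfer C⁺ → crux, dense fillings).
* card `bernoulli-root-cloud`: `CountPGFRealRooted` (first lemma), `ParityVarianceBound`,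
  `WalshMassBelowHalf` (the transfer C⁺).
-/

namespace Summit.AtomisticToContinuum.BoseEinsteinCondensation.Cruxes.KineticLatticeBEC.Ideator3

open scoped BigOperators
open Literature.MathematicalPhysics.QuantumLattice Literature.Probability.LatticeModels Matrix Finset

/-! ## Card A — odd block-staggered chemical potential restores reflection positivity -/

/-- The block sign `ε_ℓ(x) = ∏ᵢ s_ℓ(xᵢ)`, `s_ℓ(t) = +1` if `t mod 2ℓ < ℓ`, `-1` otherwise
(computed on canonical representatives; consistent on the torus when `2ℓ ∣ L`). For `ℓ = 1` it is
the ALSSY staggered sign `(-1)^{Σxᵢ}`. -/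
noncomputable def blockSign (ℓ : ℕ) {d L : ℕ} (x : TorusSite d L) : ℝ :=
  ∏ i : Fin d, (if (x i).val % (2 * ℓ) < ℓ then (1 : ℝ) else -1)

/-- The ℓ-checkerboard hard-core lattice gas: ferromagnetic spin-½ XY (= hard-core bosons) plus
the reflection-ODD chemical-potential landscape `μ Σ_x ε_ℓ(x) S³_x` (cubes of side `ℓ` with
alternating potential `±μ`; total filling ½, local fillings `ν(μ) ≠ ½` and `1 - ν(μ)`). -/
noncomputable def checkerboardGas (d L : ℕ) [NeZero L] (ℓ : ℕ) (μ : ℝ) : Op (TorusSite d L) 2 :=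
  xyTorus d L 1 + (μ : ℂ) • ∑ x : TorusSite d L, (blockSign ℓ x : ℂ) • siteSpin 1 x 2

/-- A real field is constant on the ℓ-cubes: it changes only across cube faces (between
coordinate values `≡ ℓ-1` and `≡ 0 mod ℓ`). For such `h`, `xyGradField L 1 h` only contains
cross-face bonds. -/
def IsCubeConstant (ℓ : ℕ) {d L : ℕ} (h : TorusSite d L → ℝ) : Prop :=
  ∀ (x : TorusSite d L) (i : Fin d), (x i).val % ℓ ≠ ℓ - 1 → h x = h (x + Pi.single i 1)

/-- **First lemma (card A): coarse Gaussian domination for the ℓ-checkerboard gas.**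
DLS/KLS Gaussian domination `Z_β(H - V_h + ½Q(h)) ≤ Z_β(H)` for the checkerboard Hamiltonian and
every cube-constant field `h` (so `V_h`, `Q(h)` live on cross-face bonds only), every `β > 0`,
every `μ` and every `ℓ ≥ 1` with `2ℓ ∣ L`: reflection positivity through the cube-face planes
(θ = reflection ∘ particle–hole; the potential is odd under each of them) plus the DLS descent over
the COARSE planes only. `ℓ = 1` is the tree's `hc_partitionFn_field_le` (ALSSY). -/
def CheckerboardGaussianDomination : Prop :=
  ∀ (d ℓ L : ℕ) [NeZero L], 1 ≤ ℓ → 2 * ℓ ∣ L → 4 * ℓ ≤ L → ∀ (β μ : ℝ), 0 < β →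
    ∀ h : TorusSite d L → ℝ, IsCubeConstant ℓ h →
      (partitionFn β (checkerboardGas d L ℓ μ - xyGradField L 1 h +
          ((xyFieldEnergy L h / 2 : ℝ) : ℂ) • (1 : Op (TorusSite d L) 2))).re ≤
        (partitionFn β (checkerboardGas d L ℓ μ)).re

/-- **The line's unconditional output (card A, d = 3): face-layer planar order ∝ ℓ⁻² in the
checkerboard gas.** With `F^α = Σ_{x : x₀ ≡ 0 mod ℓ} S^α_x` (all sites of the face layers
perpendicular to direction 0; `L³/ℓ` sites), the tracial ground state of the ℓ-checkerboard gas has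
`Re ω((F¹)² + (F²)²) ≥ c · L⁶/ℓ⁴` for `|μ| ≤ μ₀`, all `ℓ`, all large `L ∈ 2ℓℕ` — coarse infrared
bound (from `CheckerboardGaussianDomination`) + KLS `T = 0` transfer + the face sum rule, whose
diagonal `¼ℓ²` is scale-invariant in `ℓ`. -/
def CheckerboardFaceOrder : Prop :=
  ∃ μ₀ : ℝ, 0 < μ₀ ∧ ∃ c : ℝ, 0 < c ∧ ∀ ℓ : ℕ, 1 ≤ ℓ → ∀ μ : ℝ, |μ| ≤ μ₀ →
    ∃ m₀ : ℕ, ∀ m : ℕ, m₀ ≤ m → ∀ [NeZero (2 * ℓ * m)],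
      c * ((2 * ℓ * m : ℕ) : ℝ) ^ 6 / (ℓ : ℝ) ^ 4 ≤
        ((checkerboardGas 3 (2 * ℓ * m) ℓ μ).groundStateFunctional
          ((∑ x ∈ (univ : Finset (TorusSite 3 (2 * ℓ * m))).filter (fun x => (x 0).val % ℓ = 0),
              siteSpin 1 x 0) *
            (∑ x ∈ (univ : Finset (TorusSite 3 (2 * ℓ * m))).filter (fun x => (x 0).val % ℓ = 0),
              siteSpin 1 x 0) +
           (∑ x ∈ (univ : Finset (TorusSite 3 (2 * ℓ * m))).filter (fun x => (x 0).val % ℓ = 0),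
              siteSpin 1 x 1) *
            (∑ x ∈ (univ : Finset (TorusSite 3 (2 * ℓ * m))).filter (fun x => (x 0).val % ℓ = 0),
              siteSpin 1 x 1))).re

/-- **Local face order, uniform in ℓ (card A, the residual open statement C_loc).** Inside the
checkerboard gas the planar correlation summed over ONE face layer of one cube (ℓ² sites) is
`≥ m² ℓ⁴` uniformly in `ℓ` and in the volume: `Re ω((A¹_Q)² + (A²_Q)²) ≥ m² ℓ⁴` where
`A^α_Q = Σ_{x ∈ face layer of the cube at the origin} S^α_x`. -/
def CheckerboardLocalFaceOrder (μ : ℝ) : Prop :=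
  ∃ msq : ℝ, 0 < msq ∧ ∃ ℓ₀ : ℕ, ∀ ℓ : ℕ, ℓ₀ ≤ ℓ → ∃ m₀ : ℕ, ∀ m : ℕ, m₀ ≤ m →
    ∀ [NeZero (2 * ℓ * m)],
      msq * (ℓ : ℝ) ^ 4 ≤
        ((checkerboardGas 3 (2 * ℓ * m) ℓ μ).groundStateFunctional
          ((∑ x ∈ (univ : Finset (TorusSite 3 (2 * ℓ * m))).filter
              (fun x => (x 0).val = 0 ∧ (x 1).val < ℓ ∧ (x 2).val < ℓ), siteSpin 1 x 0) *
            (∑ x ∈ (univ : Finset (TorusSite 3 (2 * ℓ * m))).filter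
              (fun x => (x 0).val = 0 ∧ (x 1).val < ℓ ∧ (x 2).val < ℓ), siteSpin 1 x 0) +
           (∑ x ∈ (univ : Finset (TorusSite 3 (2 * ℓ * m))).filter
              (fun x => (x 0).val = 0 ∧ (x 1).val < ℓ ∧ (x 2).val < ℓ), siteSpin 1 x 1) *
            (∑ x ∈ (univ : Finset (TorusSite 3 (2 * ℓ * m))).filter
              (fun x => (x 0).val = 0 ∧ (x 1).val < ℓ ∧ (x 2).val < ℓ), siteSpin 1 x 1))).re

/-! ## Card B — Bernoulli root clouds: x-basis amplitudes are Poisson-binomial parities -/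

/-- **First lemma (card B): region counts of a stable amplitude measure are Poisson-binomial.**
If `φ ≥ 0` on subsets of `Λ` has an `H^Λ`-stable generating polynomial (Theorem S gives this for
every sector ground state of hard-core bosons, `GroundStateStability`), then for every region `A`
the count generating polynomial `u ↦ Σ_S φ(S) u^{|S ∩ A|}` has only real non-positive roots
(specialise `z_x = u` on `A`, `z_x = 1` off `A`, Hurwitz); equivalently `|S ∩ A|` under `π ∝ φ` is
a sum of independent Bernoulli(`p_j(A)`) variables, and the x-basis amplitude is the parity
`Σ_S φ(S)(-1)^{|S∩A|} = Z ∏_j (1 - 2 p_j(A))`. -/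
def CountPGFRealRooted : Prop :=
  ∀ (Λ : Type) [Fintype Λ] [DecidableEq Λ] (φ : Finset Λ → ℝ), (∀ S, 0 ≤ φ S) →
    (∀ z : Λ → ℂ, (∀ x, 0 < (z x).im) → (∑ S : Finset Λ, (φ S : ℂ) * ∏ x ∈ S, z x) ≠ 0) →
    ∀ (A : Finset Λ) (u : ℂ), (∑ S : Finset Λ, (φ S : ℂ) * u ^ (S ∩ A).card) = 0 →
      u.im = 0 ∧ u.re ≤ 0

/-- **Parity–variance bound (card B, corollary of `CountPGFRealRooted`).** For a Poisson-binomial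
count, `|E(-1)^X| = ∏|1 - 2p_j| ≤ exp(-2 Var X)`; in sums over the amplitude measure:
`|Σ_S φ(S)(-1)^{|S∩A|}| · Z ≤ Z² exp(-2 Var_π |S∩A|)` with `Z = Σ_S φ(S)`,
`Var_π X = Σ φ X²/Z - (Σ φ X/Z)²`. (An UPPER bound on x-basis amplitudes near the balanced
patterns; recorded because it is the only direction stability gives for free.) -/
def ParityVarianceBound : Prop :=
  ∀ (Λ : Type) [Fintype Λ] [DecidableEq Λ] (φ : Finset Λ → ℝ), (∀ S, 0 ≤ φ S) →
    (∀ z : Λ → ℂ, (∀ x, 0 < (z x).im) → (∑ S : Finset Λ, (φ S : ℂ) * ∏ x ∈ S, z x) ≠ 0) →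
    ∀ A : Finset Λ, 0 < ∑ S : Finset Λ, φ S →
      |∑ S : Finset Λ, φ S * (-1 : ℝ) ^ (S ∩ A).card| ≤
        (∑ S : Finset Λ, φ S) *
          Real.exp (-2 * ((∑ S : Finset Λ, φ S * ((S ∩ A).card : ℝ) ^ 2) / (∑ S : Finset Λ, φ S) -
            ((∑ S : Finset Λ, φ S * ((S ∩ A).card : ℝ)) / (∑ S : Finset Λ, φ S)) ^ 2))

/-- **The transfer C⁺ of card B (Walsh mass below the half level).** For the nonnegative
sector-`N` ground vector `ψ` of `xyTorus 3 L 1` (`φ(S) = Re ψ(1_S)`), the x-basis weights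
`w(A) = (Σ_S φ(S)(-1)^{|S∩A|})²` put mass `≥ δ` (relative to `Σ_A w(A) = 2^{L³} Σ_S φ(S)²`) on sign
patterns with a majority of at least `ε L³ √(ν(1-ν))`, `ν = N/L³`: this says
`P(S¹_tot ≥ ε L³ √(ν(1-ν))) ≥ δ`, hence `⟨S⁺_tot S⁻_tot⟩ ≥ δ ε² N L³ (1-ν)` — KineticLatticeBEC
with `c = δε²/2`. -/
def WalshMassBelowHalf : Prop :=
  ∃ ε : ℝ, 0 < ε ∧ ∃ δ : ℝ, 0 < δ ∧ ∃ L₀ : ℕ, ∀ (L : ℕ) [NeZero L], L₀ ≤ L → Even L →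
    ∀ N : ℕ, 1 ≤ N → 2 * N ≤ L ^ 3 →
    ∀ ψ : TensorIndex (TorusSite 3 L) 2 → ℂ,
      ψ ∈ spinZSector 1 ((N : ℝ) - (L : ℝ) ^ 3 / 2) → ψ ≠ 0 →
      (xyTorus 3 L 1).mulVec ψ =
        ((lowestEnergyInSector 1 (xyTorus 3 L 1) ((N : ℝ) - (L : ℝ) ^ 3 / 2) : ℝ) : ℂ) • ψ →
      (∀ σ, 0 ≤ (ψ σ).re ∧ (ψ σ).im = 0) →
      let φ : Finset (TorusSite 3 L) → ℝ := fun S => (ψ (fun x => if x ∈ S then 0 else 1)).re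
      let w : Finset (TorusSite 3 L) → ℝ := fun A => (∑ S : Finset (TorusSite 3 L),
          φ S * (-1 : ℝ) ^ (S ∩ A).card) ^ 2
      δ * ∑ A : Finset (TorusSite 3 L), w A ≤
        ∑ A ∈ (univ : Finset (Finset (TorusSite 3 L))).filter
            (fun A => (A.card : ℝ) ≤ (L : ℝ) ^ 3 / 2 -
              ε * (L : ℝ) ^ 3 * Real.sqrt ((N : ℝ) / (L : ℝ) ^ 3 * (1 - (N : ℝ) / (L : ℝ) ^ 3))),
          w A

end Summit.AtomisticToContinuum.BoseEinsteinCondensation.Cruxes.KineticLatticeBEC.Ideator3
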